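import Mathlib
import Summits.ValiantsHypothesis.ValiantsHypothesis.Theorems.BarrierLeverPartitionMinorsHitByVPHiddenStatesFullJoinExchange

/-!
# Route BarrierLever — item `PartitionMinorsHitByVP` (stmt-ValiantsHypothesis-19717), line `hidden_states`:
# THE INEXACT CUT — core independence splits along one coordinate WITHOUT size matching

Helper file (`--supports stmt-ValiantsHypothesis-19717`; cell valiant-natproofs, rung V4, 𝒟-side door (c), line
`Cruxes/PartitionMinorsHitByVP/Lines/hidden_states.lean` v9; prover seat val-np-p3 gen 19). Definition-free; closes NO item.

THE POINT (memo val-np-p3 g19 §4). By the exchange principle (`FullJoin.exists_table_of_indep_core`, p687181) a one-cube design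
with a free reservoir is good for a row family `u` as soon as SOME table makes its CORE columns
`(∏_{a ∈ u i}(tx none a + Σ_{q ∈ J c} tx (some q) a))_i` linearly INDEPENDENT — independence, not spanning. Independence admits an
INEXACT cut: fix a coordinate `a` and ANY set `Q` of states; split the core columns into those whose state set is disjoint from `Q`
(`J c ∩ Q = ∅`) and those meeting `Q`, and the rows into `a ∉ u i` / `a ∈ u i`. If ONE table `t` (whose values at coordinate `a`
are irrelevant) makes

* the `Q`-disjoint columns independent on the rows avoiding `a` (the deletion family), and
* the `Q`-meeting columns independent on the rows through `a` with `a` erased (the link family),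

then the table that agrees with `t` off `a` and reads coordinate `a` PURELY through `Q` (`tx none a = 0`, `tx (some q) a = [q ∈ Q]`)
makes ALL core columns independent (`exists_table_indep_of_cut`): on the rows through `a` the `Q`-disjoint columns vanish and the
`Q`-meeting column `c` is `|J c ∩ Q| ·` its link column, so the matrix is block triangular with independent diagonal blocks — no
equality `#(Q-meeting columns) = #(rows through a)` is needed (contrast the exact affine cuts `SymbJoin.symGood_of_split_enum`,
`symGood_of_affSplit`, where the design is square). Together with the leaf `linearIndependent_cols_of_traces` (columns placed at
indicator points of distinct rows are independent — the inclusion basis `inclusionMatrix_isUnit`, p675793) this is a recursive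
certificate calculus for core independence whose slack is the free reservoir; `good_of_cut` packages one cut + the exchange principle
into a nonsingular full design.

HONEST SCOPE (memo §4c): the slack of a one-cube threshold design is at most its number of free singletons `≤ K ≤ h³`, so in the
exponential range inexact cuts can be used only polynomially often along a certificate; the calculus is complete-with-slack only for
`r < K²/2`-type ranges. WHAT THIS IS NOT: no family is certified here; item 19717 OPEN; nothing on crux 14610 or VP ≠ VNP.
-/

set_option linter.dupNamespace false

namespace Summit.ValiantsHypothesis.ValiantsHypothesis.Theorems.BarrierLever.HiddenStates

open Finset Matrix

noncomputable section

namespace CoreCut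

variable {h K : ℕ}

/-- **THE INEXACT CUT (core independence splits along a coordinate without size matching).** Rows `u : ι → Finset (Fin h)`,
core columns `J : κ → Finset (Fin K)`, a coordinate `a` and a state set `Q`. If one table `t` makes the `Q`-disjoint columns
independent on the rows avoiding `a` and the `Q`-meeting columns independent on the rows through `a` (with `a` erased), then the
table equal to `t` off `a` and reading `a` purely through `Q` makes all columns independent. -/
theorem exists_table_indep_of_cut {ι κ : Type*} [Fintype ι] [Fintype κ]
    (u : ι → Finset (Fin h)) (J : κ → Finset (Fin K)) (a : Fin h) (Q : Finset (Fin K))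
    (t : Option (Fin K) → Fin h → ℂ)
    (h0 : LinearIndependent ℂ fun c : {c : κ // Disjoint (J c) Q} =>
      fun i : {i : ι // a ∉ u i} => ∏ b ∈ u i.1, (t none b + ∑ q ∈ J c.1, t (some q) b))
    (h1 : LinearIndependent ℂ fun c : {c : κ // ¬ Disjoint (J c) Q} =>
      fun i : {i : ι // a ∈ u i} => ∏ b ∈ (u i.1).erase a, (t none b + ∑ q ∈ J c.1, t (some q) b)) :
    ∃ tx : Option (Fin K) → Fin h → ℂ, (∀ o, ∀ b, b ≠ a → tx o b = t o b) ∧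
      LinearIndependent ℂ fun c : κ => fun i : ι => ∏ b ∈ u i, (tx none b + ∑ q ∈ J c, tx (some q) b) := by
  classical
  -- the cut table: coordinate `a` is read purely through `Q`
  let tx : Option (Fin K) → Fin h → ℂ := fun o b =>
    if b = a then (match o with | none => 0 | some q => if q ∈ Q then 1 else 0) else t o b
  have htx_off : ∀ o, ∀ b, b ≠ a → tx o b = t o b := by
    intro o b hb; simp [tx, hb]
  have htx_none : tx none a = 0 := by simp [tx]
  have htx_some : ∀ q, tx (some q) a = if q ∈ Q then 1 else 0 := by intro q; simp [tx]
  refine ⟨tx, htx_off, ?_⟩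
  -- the number of `Q`-states of a column
  let N : κ → ℂ := fun c => ((J c ∩ Q).card : ℂ)
  have hN_eq : ∀ c, tx none a + ∑ q ∈ J c, tx (some q) a = N c := by
    intro c
    rw [htx_none, zero_add]
    simp only [htx_some, Finset.sum_boole, N, Finset.filter_mem_eq_inter]
  have hN_zero : ∀ c, Disjoint (J c) Q → N c = 0 := by
    intro c hc
    simp [N, Finset.disjoint_iff_inter_eq_empty.mp hc]
  have hN_ne : ∀ c, ¬ Disjoint (J c) Q → N c ≠ 0 := by
    intro c hc
    have hne : (J c ∩ Q).Nonempty := by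
      rw [Finset.disjoint_iff_inter_eq_empty] at hc
      exact Finset.nonempty_iff_ne_empty.mpr hc
    simp only [N, ne_eq, Nat.cast_eq_zero]
    exact Finset.card_ne_zero.mpr hne
  -- entries off `a` agree with the `t`-entries
  have hfac : ∀ c (s : Finset (Fin h)), a ∉ s →
      ∏ b ∈ s, (tx none b + ∑ q ∈ J c, tx (some q) b) = ∏ b ∈ s, (t none b + ∑ q ∈ J c, t (some q) b) := by
    intro c s hs
    refine Finset.prod_congr rfl fun b hb => ?_
    have hba : b ≠ a := fun hba => hs (hba ▸ hb)
    rw [htx_off none b hba]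
    refine congrArg _ (Finset.sum_congr rfl fun q _ => htx_off (some q) b hba)
  -- rows avoiding `a`
  have hrow0 : ∀ c (i : ι), a ∉ u i →
      ∏ b ∈ u i, (tx none b + ∑ q ∈ J c, tx (some q) b) = ∏ b ∈ u i, (t none b + ∑ q ∈ J c, t (some q) b) :=
    fun c i hi => hfac c (u i) hi
  -- rows through `a`
  have hrow1 : ∀ c (i : ι), a ∈ u i →
      ∏ b ∈ u i, (tx none b + ∑ q ∈ J c, tx (some q) b) =
        N c * ∏ b ∈ (u i).erase a, (t none b + ∑ q ∈ J c, t (some q) b) := by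
    intro c i hi
    rw [← Finset.mul_prod_erase (u i) _ hi, hN_eq c, hfac c ((u i).erase a) (Finset.notMem_erase a (u i))]
  -- linear independence
  rw [Fintype.linearIndependent_iff]
  intro g hg
  have hgi : ∀ i : ι, ∑ c, g c * ∏ b ∈ u i, (tx none b + ∑ q ∈ J c, tx (some q) b) = 0 := by
    intro i
    have := congr_fun hg i
    simpa [Finset.sum_apply, Pi.smul_apply, smul_eq_mul] using this
  -- step 1: the `Q`-meeting columns
  have hstep1 : ∀ c : {c : κ // ¬ Disjoint (J c) Q}, g c.1 = 0 := by
    have key := (Fintype.linearIndependent_iff.mp h1) (fun c => g c.1 * N c.1) ?_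
    · intro c
      have := key c
      rcases mul_eq_zero.mp this with h' | h'
      · exact h'
      · exact absurd h' (hN_ne c.1 c.2)
    · funext i
      simp only [Finset.sum_apply, Pi.smul_apply, smul_eq_mul, Pi.zero_apply]
      have hsplit := Fintype.sum_subtype_add_sum_subtype (fun c : κ => Disjoint (J c) Q)
        (fun c => g c * ∏ b ∈ u i.1, (tx none b + ∑ q ∈ J c, tx (some q) b))
      have hzero : ∑ c : {c : κ // Disjoint (J c) Q},
          g c.1 * ∏ b ∈ u i.1, (tx none b + ∑ q ∈ J c.1, tx (some q) b) = 0 := by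
        refine Finset.sum_eq_zero fun c _ => ?_
        rw [hrow1 c.1 i.1 i.2, hN_zero c.1 c.2]; ring
      rw [hzero, zero_add, hgi i.1] at hsplit
      rw [← hsplit]
      refine Finset.sum_congr rfl fun c _ => ?_
      rw [hrow1 c.1 i.1 i.2]; ring
  -- step 2: the `Q`-disjoint columns
  have hstep2 : ∀ c : {c : κ // Disjoint (J c) Q}, g c.1 = 0 := by
    have key := (Fintype.linearIndependent_iff.mp h0) (fun c => g c.1) ?_
    · exact key
    · funext i
      simp only [Finset.sum_apply, Pi.smul_apply, smul_eq_mul, Pi.zero_apply]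
      have hsplit := Fintype.sum_subtype_add_sum_subtype (fun c : κ => Disjoint (J c) Q)
        (fun c => g c * ∏ b ∈ u i.1, (tx none b + ∑ q ∈ J c, tx (some q) b))
      have hzero : ∑ c : {c : κ // ¬ Disjoint (J c) Q},
          g c.1 * ∏ b ∈ u i.1, (tx none b + ∑ q ∈ J c.1, tx (some q) b) = 0 := by
        refine Finset.sum_eq_zero fun c _ => ?_
        rw [hstep1 c]; ring
      rw [hzero, add_zero, hgi i.1] at hsplit
      rw [← hsplit]
      refine Finset.sum_congr rfl fun c _ => ?_
      rw [hrow0 c.1 i.1 i.2]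
  intro c
  by_cases hc : Disjoint (J c) Q
  · exact hstep2 ⟨c, hc⟩
  · exact hstep1 ⟨c, hc⟩

/-- **LEAF (trace placement).** If a table places the hidden point of every core column `c` at the indicator point of a row
`u (φ c)` for an INJECTIVE `φ` (i.e. `tx none b + Σ_{q ∈ J c} tx (some q) b = [b ∈ u (φ c)]`), then the core columns are the
columns `φ c` of the inclusion matrix `[u i ⊆ u k]`, hence linearly independent (`inclusionMatrix_isUnit`). Indicator-independent
state-set families always admit such a table (one linear system per coordinate); this is the leaf of the cut calculus. -/
theorem linearIndependent_cols_of_traces {κ : Type*} {r : ℕ}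
    (u : Fin r → Finset (Fin h)) (hu : Function.Injective u) (J : κ → Finset (Fin K))
    (φ : κ → Fin r) (hφ : Function.Injective φ) (tx : Option (Fin K) → Fin h → ℂ)
    (htx : ∀ c b, tx none b + ∑ q ∈ J c, tx (some q) b = if b ∈ u (φ c) then 1 else 0) :
    LinearIndependent ℂ fun c : κ => fun i : Fin r => ∏ b ∈ u i, (tx none b + ∑ q ∈ J c, tx (some q) b) := by
  classical
  have hcols := Matrix.linearIndependent_cols_iff_isUnit.mpr (FullJoin.inclusionMatrix_isUnit u hu)
  have heq : (fun c : κ => fun i : Fin r => ∏ b ∈ u i, (tx none b + ∑ q ∈ J c, tx (some q) b)) =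
      (fun k : Fin r => (Matrix.of fun i k : Fin r => if u i ⊆ u k then (1 : ℂ) else 0).col k) ∘ φ := by
    funext c i
    simp only [Function.comp_apply, Matrix.col_apply, Matrix.of_apply]
    rw [Finset.prod_congr rfl fun b _ => htx c b, Finset.prod_boole]
    by_cases hsub : u i ⊆ u (φ c)
    · rw [if_pos hsub, if_pos (fun b hb => hsub hb)]
    · rw [if_neg hsub, if_neg (fun hall => hsub (fun b hb => hall b hb))]
  rw [heq]
  exact hcols.comp φ hφ

/-- **One inexact cut + the exchange principle ⇒ a good design.** For a one-cube design `J` (injective) with a free reservoir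
outside `core` (`hfree`) and an injective row family `u`: if at some coordinate `a` and state set `Q` one table makes the
`Q`-disjoint core columns independent on the deletion rows and the `Q`-meeting core columns independent on the link rows, then
some table makes the whole design matrix nonsingular (`exists_table_indep_of_cut` + `FullJoin.exists_table_of_indep_core`). -/
theorem good_of_cut {r : ℕ} (u : Fin r → Finset (Fin h)) (hu : Function.Injective u)
    (J : Fin r → Finset (Fin K)) (hJ : Function.Injective J) (core : Finset (Fin K))
    (hfree : ∀ k, ¬ J k ⊆ core → ∃ q, q ∉ core ∧ J k = {q})
    (a : Fin h) (Q : Finset (Fin K)) (t : Option (Fin K) → Fin h → ℂ)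
    (h0 : LinearIndependent ℂ fun c : {c : {k : Fin r // J k ⊆ core} // Disjoint (J c.1) Q} =>
      fun i : {i : Fin r // a ∉ u i} => ∏ b ∈ u i.1, (t none b + ∑ q ∈ J c.1.1, t (some q) b))
    (h1 : LinearIndependent ℂ fun c : {c : {k : Fin r // J k ⊆ core} // ¬ Disjoint (J c.1) Q} =>
      fun i : {i : Fin r // a ∈ u i} => ∏ b ∈ (u i.1).erase a, (t none b + ∑ q ∈ J c.1.1, t (some q) b)) :
    ∃ tx : Option (Fin K) → Fin h → ℂ,
      (Matrix.of fun i k : Fin r => ∏ b ∈ u i, (tx none b + ∑ q ∈ J k, tx (some q) b)).det ≠ 0 := by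
  classical
  obtain ⟨tx₀, -, hind⟩ := exists_table_indep_of_cut (κ := {k : Fin r // J k ⊆ core}) u (fun c => J c.1) a Q t h0 h1
  obtain ⟨tx, -, -, hdet⟩ := FullJoin.exists_table_of_indep_core u hu J hJ core hfree tx₀ hind
  exact ⟨tx, hdet⟩

end CoreCut

end

end Summit.ValiantsHypothesis.ValiantsHypothesis.Theorems.BarrierLever.HiddenStates
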